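import Mathlib
import HarnessLib
import Literature.Analysis.FluidPDE.AxisymmetricVorticityTransport
import Literature.Analysis.FluidPDE.PineauVicolRSS
import Literature.Analysis.FluidPDE.PineauVicolRSSHolds
import Literature.Analysis.FluidPDE.PineauVicolRDSSLiouvilleHolds
import Literature.Analysis.FluidPDE.SuitableWeak
import Literature.Analysis.FluidPDE.HyperbolicDSSOrbit
import Literature.Analysis.FluidPDE.AncientSimilarityVariables
import Literature.Analysis.FluidPDE.PineauVicolAngularMean
import Summits.NavierStokesRegularity.NavierStokesRegularity.Theorems.PeepholeEchoDoorTwistedDoors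
import Summits.NavierStokesRegularity.NavierStokesRegularity.Theorems.CorkscrewDynamoCorkscrewProfileRdssIterate

/-!
# PeepholeEchoDoorNearOneTwisted — S23 «PeepholeEchoDoor» ADDENDUM-22R-2 (near-one twisted stratum), part 8/8

§6.8–6.9: a SINGLE twisted echo at a ratio `κ` near `1` whose twist is a rotation `rotZ θ` about a fixed axis.  The profile's
past cut is rotated-DSS with factor `c = (√κ)⁻¹` and twist `rotZ(−θ)` (`isRotatedDSS_pastCut`, part 6), hence — by the RDSS
DICTIONARY `RDSSDictionary` (PROVED here: `rdssDictionary_holds`; profile `dictProfile α v y s = R(−αs) V(s, R(αs) y)` with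
`V = lerayOrbit v`; periodicity from the tree's `IsRotatedDSS.lerayOrbit_add_period`, smoothness from `contDiff_uncurry_lerayOrbit`
+ `contDiff_rotZ_uncurry`, ansatz identity from `lerayOrbit_neg_log`) — Pineau–Vicol's RDSS ansatz (1.13a) with angular speed
`α = θ/(−log κ)`, and PV 2026 Thm 1.7 (tree THEOREM `pineauVicol2026_rdss_liouville_holds`) kills it in both of its regimes:
(i) slow twist `|θ| ≤ α₁·(−log κ)`, `κ > c₁⁻²` (`echoResidueDecayAtR_nearOneTwisted`); (ii) rapid twist `|θ| ≥ α₂·(−log κ)`,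
`(−log κ) + θ²/(−log κ) < 2 log c₂` (`echoResidueDecayAtR_nearOneRapidTwist`).  **Doors T5-R(i) `targetNearOneTwistedEcho_holds :
TargetNearOneTwistedEcho` and T5-R(ii) `targetNearOneRapidTwistEcho_holds : TargetNearOneRapidTwistEcho` PROVED** («no near-one
slowly- or rapidly-twisting single echo»).  The complement (ratio far from `1`, intermediate twist angle, or twist not about a fixed
axis through the whole echo sequence) stays in the rotated wall `RotatedTypeIDSSLiouville` (part 6) — hard core 10661, RDSS stratum.

Door family of LADDER-NS N0; THEOREMS-ONLY landing of the nsreg-p1 design `run/shared/lean/pub/ns-regularity-ideate/ns-regularity-ideate-p1/r22/r22R/Sketch23R2.lean`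
(ADDENDUM-22R-2.md); no route, no items (DIRECTOR-NS standing #32 (2)). WHAT THIS IS NOT: not a regularity claim; not an attack on Tsai Conj. 8.9 / PV Conj. 1.1.
-/

noncomputable section

set_option linter.dupNamespace false

namespace Summit.NavierStokesRegularity.NavierStokesRegularity.Theorems.PeepholeEchoDoorNearOneTwisted

open MeasureTheory Set Function Filter Topology TopologicalSpace Metric
open scoped RealInnerProductSpace NNReal ENNReal Topology Pointwise
open Literature.Analysis Literature.Analysis.FluidPDE
open Summit.NavierStokesRegularity.NavierStokesRegularity.Theorems.LocalSineTubeDoorProfileAlignedWindowRigidityAncient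
open Summit.NavierStokesRegularity.NavierStokesRegularity.Theorems.PoloidalWindowDoorPoloidalWindowRigidityStrata
open Summit.NavierStokesRegularity.NavierStokesRegularity.Theorems.PoloidalWindowDoorPoloidalWindowRigidityFlat
open Summit.NavierStokesRegularity.NavierStokesRegularity.Theorems.PoloidalWindowDoorPoloidalWindowRigidityWindow
open Summit.NavierStokesRegularity.NavierStokesRegularity.Theorems.PeepholeEchoDoorDefs
open Summit.NavierStokesRegularity.NavierStokesRegularity.Theorems.PeepholeEchoDoorCore
open Summit.NavierStokesRegularity.NavierStokesRegularity.Theorems.PeepholeEchoDoorResidues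
open Summit.NavierStokesRegularity.NavierStokesRegularity.Theorems.PeepholeEchoDoorDoors
open Summit.NavierStokesRegularity.NavierStokesRegularity.Theorems.PeepholeEchoDoorTwisted
open Summit.NavierStokesRegularity.NavierStokesRegularity.Theorems.PeepholeEchoDoorTwistedDoors

/-! ### §6.8 The near-one twisted stratum (Pineau–Vicol 2026, Thm 1.7 (i) and (ii)) through the RDSS DICTIONARY

A SINGLE twisted echo at a ratio `κ` near `1` whose twist is a rotation `rotZ θ` about a fixed axis: the profile's past cut is
rotated-DSS with factor `c = (√κ)⁻¹` near `1` and twist `rotZ(−θ)` (`isRotatedDSS_pastCut`), i.e. — by the DICTIONARY below —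
Pineau–Vicol's RDSS ansatz (1.13a) with angular speed `α = θ/(−log κ) = θ/(2 log c)` and a `C²`, `2 log c`-periodic profile.
PV 2026 Thm 1.7 (tree THEOREM `pineauVicol2026_rdss_liouville_holds`) kills the profile in its two regimes:
(i) SLOW twist `|θ| ≤ α₁·(−log κ)`, `κ > c₁⁻²`; (ii) RAPID twist `|θ| ≥ α₂·(−log κ)` with `(−log κ) + θ²/(−log κ) < 2 log c₂`
(PV's window `c < c₂^{1/(1+α²)}`).  The dictionary `RDSSDictionary` (converse of the tree lemma
`PineauVicol2026.isRotatedDSS_pvAnsatz`) is typed here and PROVED in §6.9; doors T5-R(i) `TargetNearOneTwistedEcho` and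
T5-R(ii) `TargetNearOneRapidTwistEcho` follow (`…_of_dictionary`, and unconditionally `…_holds` in §6.9). -/

section NearOneTwisted

variable {v : ℝ → EuclideanSpace ℝ (Fin 3) → EuclideanSpace ℝ (Fin 3)}

-- `(rotZLIE θ).symm = rotZLIE (-θ)` is the tree lemma `CorkscrewProfile.Birth.rotZLIE_symm` (CorkscrewDynamoCorkscrewProfileRdssIterate), reused below.

/-- support (rank 9) · THE RDSS DICTIONARY (converse of the tree lemma `PineauVicol2026.isRotatedDSS_pvAnsatz`; PROVED in §6.9,
`rdssDictionary_holds`): a field smooth on the open past which is rotated-DSS with factor `c > 1` and twist `rotZ θ` coincides on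
`[−1,0)` with Pineau–Vicol's RDSS ansatz (1.13a) `pvAnsatz α U` for the angular speed `α = −θ/(2 log c)` and some profile
`U ∈ C²(ℝ³ × ℝ)` which is `2 log c`-periodic in `s` (namely `U(y,s) = R(−αs) V(s, R(αs) y)`, `V = lerayOrbit v`). -/
def RDSSDictionary : Prop :=
  ∀ (c θ : ℝ), 1 < c → ∀ v : ℝ → EuclideanSpace ℝ (Fin 3) → EuclideanSpace ℝ (Fin 3), ContDiffOn ℝ (⊤ : ℕ∞) (Function.uncurry v) (Set.Iio (0 : ℝ) ×ˢ Set.univ) → Literature.Analysis.FluidPDE.IsRotatedDSS c (Literature.Analysis.FluidPDE.rotZLIE θ) v → ∃ U : EuclideanSpace ℝ (Fin 3) → ℝ → EuclideanSpace ℝ (Fin 3), ContDiff ℝ 2 (fun q : EuclideanSpace ℝ (Fin 3) × ℝ => U q.1 q.2) ∧ (∀ (y : EuclideanSpace ℝ (Fin 3)) (s : ℝ), U y (s + 2 * Real.log c) = U y s) ∧ ∀ t ∈ Set.Ico (-1 : ℝ) 0, ∀ x, v t x = Literature.Analysis.FluidPDE.pvAnsatz (-θ / (2 * Real.log c)) U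 t x

/-- target (rank 0) · DOOR T5-R(i) «no near-one slowly-twisting single echo» (SPACE–time local Type I, constants `ν, M`): there are
`a₁ > 0` and `κ₁ < 1` (Pineau–Vicol's `α₁(M/ν)`, `c₁(M/ν)⁻²`) such that for every ratio `κ ∈ (κ₁, 1)` and every twist angle
`|θ| ≤ a₁·(−log κ)` the single-twisted-echo door `TargetEchoDecayAtR ν M κ (rotZ θ)` holds.  PROVED (`targetNearOneTwistedEcho_holds`). -/
def TargetNearOneTwistedEcho : Prop :=
  ∀ (ν M : ℝ), 0 < ν → ∃ a₁ κ₁ : ℝ, 0 < a₁ ∧ 0 < κ₁ ∧ κ₁ < 1 ∧ ∀ (κ θ : ℝ), κ₁ < κ → κ < 1 → |θ| ≤ a₁ * (-Real.log κ) → TargetEchoDecayAtR ν M κ (Literature.Analysis.FluidPDE.rotZLIE θ)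

/-- target (rank 0) · DOOR T5-R(ii) «no near-one rapidly-twisting single echo»: there are `a₂ > 0` and `L₂ > 0` (Pineau–Vicol's
`α₂(M/ν)`, `2 log c₂(M/ν)`) such that for every ratio `κ ∈ (0,1)` and every twist angle with `a₂·(−log κ) ≤ |θ|` and
`(−log κ) + θ²/(−log κ) < L₂` (PV's window `c < c₂^{1/(1+α²)}`, `α = θ/(−log κ)`, `c = (√κ)⁻¹`) the single-twisted-echo door
`TargetEchoDecayAtR ν M κ (rotZ θ)` holds.  PROVED (`targetNearOneRapidTwistEcho_holds`). -/
def TargetNearOneRapidTwistEcho : Prop :=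
  ∀ (ν M : ℝ), 0 < ν → ∃ a₂ L₂ : ℝ, 0 < a₂ ∧ 0 < L₂ ∧ ∀ (κ θ : ℝ), 0 < κ → κ < 1 → a₂ * (-Real.log κ) ≤ |θ| → -Real.log κ + θ ^ 2 / (-Real.log κ) < L₂ → TargetEchoDecayAtR ν M κ (Literature.Analysis.FluidPDE.rotZLIE θ)

/-- A profile vanishing on the unit open backward slab `(−1,0) × ℝ³` is not backward-singular at the apex. -/
theorem not_backwardSingular_of_zero_near (hzero : ∀ t : ℝ, -1 < t → t < 0 → ∀ y, v t y = 0) :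
    ¬ IsBackwardSingularPoint v 0 := by
  intro hsing
  have h1 := hsing 1 one_pos
  have hmeas : MeasurableSet (parabolicCylinder 1 (0 : ℝ × (EuclideanSpace ℝ (Fin 3)))) :=
    show MeasurableSet (Ioo _ _ ×ˢ ball _ _) from measurableSet_Ioo.prod measurableSet_ball
  have hle : eLpNorm (uncurry v) ∞ (volume.restrict (parabolicCylinder 1 (0 : ℝ × (EuclideanSpace ℝ (Fin 3))))) ≤
      ENNReal.ofReal 0 := by
    rw [eLpNorm_exponent_top]
    refine eLpNormEssSup_le_of_ae_bound ((ae_restrict_iff' hmeas).2 (Eventually.of_forall ?_))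
    intro z hz
    have hz' : z ∈ Ioo ((0 : ℝ × (EuclideanSpace ℝ (Fin 3))).1 - 1 ^ 2) (0 : ℝ × (EuclideanSpace ℝ (Fin 3))).1 ×ˢ
        ball (0 : ℝ × (EuclideanSpace ℝ (Fin 3))).2 1 := hz
    have hz0 : z.1 < 0 := by simpa using (mem_prod.1 hz').1.2
    have hz1 : -1 < z.1 := by simpa using (mem_prod.1 hz').1.1
    show ‖v z.1 z.2‖ ≤ 0
    rw [hzero z.1 hz1 hz0 z.2, norm_zero]
  exact absurd h1 (hle.trans_lt ENNReal.ofReal_lt_top).ne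

/-- The common data of a twisted echo about a fixed axis (given the dictionary): the profile's past cut is a classical Type-I
solution on `[−1,0)` in Pineau–Vicol's RDSS ansatz form with factor `c = (√κ)⁻¹`, angular speed `θ/(−log κ)` and a `C²`,
`2 log c`-periodic profile. -/
theorem rdssAnsatz_of_twisted (hdict : RDSSDictionary) {D κ θ C : ℝ} (hκ : 0 < κ) (hκ1 : κ < 1)
    (hrate : HasTypeITimeDecay C v) (hdecay : HasTypeIDecay D v) (hcont : ContinuousOn (uncurry v) (Iio 0 ×ˢ univ))
    (hmild : ∀ s t : ℝ, s < t → t < 0 → ∀ x,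
      v t x = Literature.Analysis.UnboundedOperators.heatExtension (v s) (t - s) x - oseenDuhamel 1 s v v t x)
    (hdiv : ∀ t < 0, VectorCalculus.IsDivFree (v t)) (hsym : HasTwistedSymmetry κ (Real.sqrt κ) (rotZLIE θ) v) :
    ∃ (q : ℝ → EuclideanSpace ℝ (Fin 3) → ℝ) (U : EuclideanSpace ℝ (Fin 3) → ℝ → EuclideanSpace ℝ (Fin 3)),
      1 < (Real.sqrt κ)⁻¹ ∧ 2 * Real.log (Real.sqrt κ)⁻¹ = -Real.log κ ∧ 0 < -Real.log κ ∧
      IsClassicalNSSolutionOn (Ico (-1) 0) 1 0 (pastCut v) q ∧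
      (∀ t ∈ Ico (-1 : ℝ) 0, ∀ x : EuclideanSpace ℝ (Fin 3), ‖pastCut v t x‖ ≤ D / (‖x‖ + Real.sqrt (-t))) ∧
      ContDiff ℝ 2 (fun q : EuclideanSpace ℝ (Fin 3) × ℝ => U q.1 q.2) ∧
      (∀ (y : EuclideanSpace ℝ (Fin 3)) (s : ℝ), U y (s + 2 * Real.log (Real.sqrt κ)⁻¹) = U y s) ∧
      (∀ t ∈ Ico (-1 : ℝ) 0, ∀ x, pastCut v t x = pvAnsatz (θ / -Real.log κ) U t x) := by
  have hsκ : 0 < Real.sqrt κ := Real.sqrt_pos.2 hκ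
  have hsκ1 : Real.sqrt κ < 1 := by
    have h := Real.sqrt_lt_sqrt hκ.le hκ1
    rwa [Real.sqrt_one] at h
  have hc1 : 1 < (Real.sqrt κ)⁻¹ := (one_lt_inv₀ hsκ).2 hsκ1
  have hlogc : 2 * Real.log (Real.sqrt κ)⁻¹ = -Real.log κ := by
    rw [Real.log_inv, Real.log_sqrt hκ.le]; ring
  have hlogκ : 0 < -Real.log κ := by
    have := Real.log_neg hκ hκ1
    linarith
  have hclass : IsTypeIAncientMild C (pastCut v) :=
    isTypeIAncientMild_pastCut (isTypeIAncientMild_of_class hrate hcont hmild hdiv)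
  obtain ⟨q, hq⟩ :=
    Summit.NavierStokesRegularity.NavierStokesRegularity.Theorems.exists_isClassicalNSSolutionOn_Iio_of_isTypeIAncientMild
      hclass
  have hsol : IsClassicalNSSolutionOn (Ico (-1) 0) 1 0 (pastCut v) q :=
    hq.mono Ico_subset_Iio_self (uniqueDiffOn_Ico _ _)
  have hbound : ∀ t ∈ Ico (-1 : ℝ) 0, ∀ x : EuclideanSpace ℝ (Fin 3), ‖pastCut v t x‖ ≤ D / (‖x‖ + Real.sqrt (-t)) :=
    fun t ht x => by rw [pastCut_of_neg ht.2]; exact hdecay t ht.2 x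
  have hrdss : IsRotatedDSS (Real.sqrt κ)⁻¹ (rotZLIE (-θ)) (pastCut v) := by
    rw [← Summit.NavierStokesRegularity.NavierStokesRegularity.Theorems.CorkscrewProfile.Birth.rotZLIE_symm]
    exact isRotatedDSS_pastCut hκ hsym
  obtain ⟨U, hU2, hper, hansatz⟩ := hdict _ (-θ) hc1 (pastCut v) hclass.contDiffOn hrdss
  rw [neg_neg, hlogc] at hansatz
  exact ⟨q, U, hc1, hlogc, hlogκ, hsol, hbound, hU2, hper, hansatz⟩

/-- If the RDSS profile of the past cut vanishes on one period, the zoom profile is not backward-singular. -/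
theorem not_backwardSingular_of_rdssProfile_zero {α S : ℝ} {U : EuclideanSpace ℝ (Fin 3) → ℝ → EuclideanSpace ℝ (Fin 3)}
    (hS : 0 < S) (hper : ∀ (y : EuclideanSpace ℝ (Fin 3)) (s : ℝ), U y (s + S) = U y s)
    (hansatz : ∀ t ∈ Ico (-1 : ℝ) 0, ∀ x, pastCut v t x = pvAnsatz α U t x)
    (hU0 : ∀ (y : EuclideanSpace ℝ (Fin 3)), ∀ s ∈ Icc (0 : ℝ) S, U y s = 0) : ¬ IsBackwardSingularPoint v 0 := by
  have hUall : ∀ y s, U y s = 0 := fun y s => by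
    have hpy : Function.Periodic (U y) S := fun s => hper y s
    obtain ⟨s', hs', hys⟩ := hpy.exists_mem_Ico₀ hS s
    rw [hys]
    exact hU0 y s' ⟨hs'.1, hs'.2.le⟩
  have hUz : U = fun _ _ => 0 := funext fun y => funext fun s => hUall y s
  have hzero : ∀ t : ℝ, -1 < t → t < 0 → ∀ x, v t x = 0 := fun t ht1 ht0 x => by
    have h := hansatz t ⟨ht1.le, ht0⟩ x
    rw [pastCut_of_neg ht0] at h
    rw [h]
    simp only [pvAnsatz, hUz, ← rotZLIE_apply, map_zero, smul_zero]
  exact not_backwardSingular_of_zero_near hzero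

/-- **THE NEAR-ONE SLOWLY-TWISTING ECHO RESIDUE (PROVED modulo the dictionary; Pineau–Vicol 2026 Thm 1.7 (i)).** -/
theorem echoResidueDecayAtR_nearOneTwisted (hdict : RDSSDictionary) (D : ℝ) :
    ∃ a₁ κ₁ : ℝ, 0 < a₁ ∧ 0 < κ₁ ∧ κ₁ < 1 ∧ ∀ (κ θ : ℝ), κ₁ < κ → κ < 1 → |θ| ≤ a₁ * (-Real.log κ) →
      EchoResidueDecayAtR D κ (rotZLIE θ) := by
  rcases le_or_gt D 0 with hD | hD
  · refine ⟨1, 1 / 2, one_pos, by norm_num, by norm_num, fun κ θ _ _ _ => ?_⟩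
    intro C v hrate hdecay hcont hmild hdiv hsym hsing
    exact not_backwardSingular_of_zero (eq_zero_of_hasTypeIDecay_nonpos hD hdecay) hsing
  obtain ⟨⟨α₁, c₁, hα₁, hc₁, H⟩, -⟩ := pineauVicol2026_rdss_liouville_holds D hD
  have hc₁pos : 0 < c₁ := zero_lt_one.trans hc₁
  have hc₁sq : 1 < c₁ ^ 2 := by nlinarith
  refine ⟨α₁, (c₁ ^ 2)⁻¹, hα₁, by positivity, inv_lt_one_of_one_lt₀ hc₁sq, fun κ θ hκ₁ hκ1 hθ => ?_⟩
  have hκ : 0 < κ := (inv_pos.2 (zero_lt_one.trans hc₁sq)).trans hκ₁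
  intro C v hrate hdecay hcont hmild hdiv hsym
  obtain ⟨q, U, hc1, hlogc, hlogκ, hsol, hbound, hU2, hper, hansatz⟩ :=
    rdssAnsatz_of_twisted hdict hκ hκ1 hrate hdecay hcont hmild hdiv hsym
  have hsκ : 0 < Real.sqrt κ := Real.sqrt_pos.2 hκ
  have hcc₁ : (Real.sqrt κ)⁻¹ < c₁ := by
    rw [inv_lt_comm₀ hsκ hc₁pos]
    have h := Real.sqrt_lt_sqrt (inv_pos.2 (zero_lt_one.trans hc₁sq)).le hκ₁
    rwa [Real.sqrt_inv, Real.sqrt_sq hc₁pos.le] at h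
  have hα : |θ / -Real.log κ| ≤ α₁ := by
    rw [abs_div, abs_of_pos hlogκ, div_le_iff₀ hlogκ]
    exact hθ
  have hU0 : ∀ y, ∀ s ∈ Icc (0 : ℝ) (2 * Real.log (Real.sqrt κ)⁻¹), U y s = 0 :=
    H _ _ (pastCut v) q U hα hc1 hcc₁ hsol hbound hU2 hper hansatz
  exact not_backwardSingular_of_rdssProfile_zero (by rw [hlogc]; exact hlogκ) hper hansatz hU0

/-- **THE NEAR-ONE RAPIDLY-TWISTING ECHO RESIDUE (PROVED modulo the dictionary; Pineau–Vicol 2026 Thm 1.7 (ii)).** -/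
theorem echoResidueDecayAtR_nearOneRapidTwist (hdict : RDSSDictionary) (D : ℝ) :
    ∃ a₂ L₂ : ℝ, 0 < a₂ ∧ 0 < L₂ ∧ ∀ (κ θ : ℝ), 0 < κ → κ < 1 → a₂ * (-Real.log κ) ≤ |θ| →
      -Real.log κ + θ ^ 2 / (-Real.log κ) < L₂ → EchoResidueDecayAtR D κ (rotZLIE θ) := by
  rcases le_or_gt D 0 with hD | hD
  · refine ⟨1, 1, one_pos, one_pos, fun κ θ _ _ _ _ => ?_⟩
    intro C v hrate hdecay hcont hmild hdiv hsym hsing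
    exact not_backwardSingular_of_zero (eq_zero_of_hasTypeIDecay_nonpos hD hdecay) hsing
  obtain ⟨-, ⟨α₂, c₂, hα₂, hc₂, H⟩⟩ := pineauVicol2026_rdss_liouville_holds D hD
  have hc₂pos : 0 < c₂ := zero_lt_one.trans hc₂
  have hlc₂ : 0 < Real.log c₂ := Real.log_pos hc₂
  refine ⟨α₂, 2 * Real.log c₂, hα₂, by positivity, fun κ θ hκ hκ1 hθ hL => ?_⟩
  intro C v hrate hdecay hcont hmild hdiv hsym
  obtain ⟨q, U, hc1, hlogc, hlogκ, hsol, hbound, hU2, hper, hansatz⟩ :=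
    rdssAnsatz_of_twisted hdict hκ hκ1 hrate hdecay hcont hmild hdiv hsym
  have hsκ : 0 < Real.sqrt κ := Real.sqrt_pos.2 hκ
  have hα : α₂ ≤ |θ / -Real.log κ| := by
    rw [abs_div, abs_of_pos hlogκ, le_div_iff₀ hlogκ]
    exact hθ
  have hlc : Real.log (Real.sqrt κ)⁻¹ = -Real.log κ / 2 := by linarith [hlogc]
  have h1 : 0 < 1 + (θ / -Real.log κ) ^ 2 := by positivity
  have hcc₂ : (Real.sqrt κ)⁻¹ < c₂ ^ (1 / (1 + (θ / -Real.log κ) ^ 2)) := by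
    rw [Real.lt_rpow_iff_log_lt (inv_pos.2 hsκ) hc₂pos, hlc, one_div, inv_mul_eq_div, lt_div_iff₀ h1]
    have hℓ : Real.log κ ≠ 0 := (show Real.log κ < 0 by linarith).ne
    have : -Real.log κ / 2 * (1 + (θ / -Real.log κ) ^ 2) = (-Real.log κ + θ ^ 2 / (-Real.log κ)) / 2 := by
      field_simp
      ring
    rw [this]
    linarith
  have hU0 : ∀ y, ∀ s ∈ Icc (0 : ℝ) (2 * Real.log (Real.sqrt κ)⁻¹), U y s = 0 :=
    H _ _ (pastCut v) q U hα hc1 hcc₂ hsol hbound hU2 hper hansatz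
  exact not_backwardSingular_of_rdssProfile_zero (by rw [hlogc]; exact hlogκ) hper hansatz hU0

/-- **DOOR T5-R(i) (PROVED modulo the RDSS dictionary).** -/
theorem targetNearOneTwistedEcho_of_dictionary (hdict : RDSSDictionary) : TargetNearOneTwistedEcho := by
  intro ν M hν
  obtain ⟨a₁, κ₁, ha₁, hκ₁, hκ₁1, hres⟩ := echoResidueDecayAtR_nearOneTwisted hdict (M / ν)
  exact ⟨a₁, κ₁, ha₁, hκ₁, hκ₁1, fun κ θ h1 h2 h3 =>
    closesEchoDecayAtR ν M κ (rotZLIE θ) hν (hκ₁.trans h1) (hres κ θ h1 h2 h3)⟩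

/-- **DOOR T5-R(ii) (PROVED modulo the RDSS dictionary).** -/
theorem targetNearOneRapidTwistEcho_of_dictionary (hdict : RDSSDictionary) : TargetNearOneRapidTwistEcho := by
  intro ν M hν
  obtain ⟨a₂, L₂, ha₂, hL₂, hres⟩ := echoResidueDecayAtR_nearOneRapidTwist hdict (M / ν)
  exact ⟨a₂, L₂, ha₂, hL₂, fun κ θ h1 h2 h3 h4 => closesEchoDecayAtR ν M κ (rotZLIE θ) hν h1 (hres κ θ h1 h2 h3 h4)⟩

end NearOneTwisted

/-! ### §6.9 The RDSS dictionary PROVED — door T5-R is a THEOREM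

The dictionary profile is `U(y,s) := R(−αs) V(s, R(αs) y)` with `V = lerayOrbit v` the tree's Leray similarity orbit:
the ansatz identity is `lerayOrbit_neg_log`, the `2 log c`-periodicity is the tree's twisted periodicity
`IsRotatedDSS.lerayOrbit_add_period` plus `α·2log c = −θ`, and joint smoothness is `contDiff_uncurry_lerayOrbit` composed with
`contDiff_rotZ_uncurry`. -/

section Dictionary

variable {v : ℝ → EuclideanSpace ℝ (Fin 3) → EuclideanSpace ℝ (Fin 3)}

/-- The dictionary profile `U(y,s) = R(−αs) V(s, R(αs) y)`, `V = lerayOrbit v`. -/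
def dictProfile (α : ℝ) (v : ℝ → EuclideanSpace ℝ (Fin 3) → EuclideanSpace ℝ (Fin 3))
    (y : EuclideanSpace ℝ (Fin 3)) (s : ℝ) : EuclideanSpace ℝ (Fin 3) :=
  rotZ (-(α * s)) (lerayOrbit v s (rotZ (α * s) y))

/-- The ansatz identity: `pvAnsatz α (dictProfile α v) = v` on the past (no self-similarity needed). -/
theorem pvAnsatz_dictProfile (α : ℝ) (v : ℝ → EuclideanSpace ℝ (Fin 3) → EuclideanSpace ℝ (Fin 3)) {t : ℝ}
    (ht : t < 0) (x : EuclideanSpace ℝ (Fin 3)) : pvAnsatz α (dictProfile α v) t x = v t x := by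
  have hsq : Real.sqrt (-t) ≠ 0 := (Real.sqrt_pos.2 (neg_pos.2 ht)).ne'
  simp only [pvAnsatz, dictProfile, ← rotZ_add, add_neg_cancel, rotZ_zero]
  rw [lerayOrbit_neg_log v ht x, smul_smul, inv_mul_cancel₀ hsq, one_smul]

/-- Twisted periodicity of the Leray orbit ⇒ plain `2 log c`-periodicity of the dictionary profile with `α = −θ/(2 log c)`. -/
theorem dictProfile_add_period {c θ : ℝ} (hc : 1 < c) (hR : IsRotatedDSS c (rotZLIE θ) v)
    (y : EuclideanSpace ℝ (Fin 3)) (s : ℝ) :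
    dictProfile (-θ / (2 * Real.log c)) v y (s + 2 * Real.log c) = dictProfile (-θ / (2 * Real.log c)) v y s := by
  have hc0 : 0 < c := zero_lt_one.trans hc
  have hS : 2 * Real.log c ≠ 0 := mul_ne_zero two_ne_zero (Real.log_pos hc).ne'
  set α : ℝ := -θ / (2 * Real.log c) with hα
  have hαS : α * (2 * Real.log c) = -θ := by rw [hα, div_mul_cancel₀ _ hS]
  have h1 : -(α * (s + 2 * Real.log c)) + -θ = -(α * s) := by linear_combination -hαS
  have h2 : θ + α * (s + 2 * Real.log c) = α * s := by linear_combination hαS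
  simp only [dictProfile]
  rw [hR.lerayOrbit_add_period hc0, rotZLIE_symm_apply, rotZLIE_apply, ← rotZ_add, ← rotZ_add, h1, h2]

/-- Joint smoothness of the dictionary profile. -/
theorem contDiff_dictProfile (α : ℝ) (hv : ContDiffOn ℝ (⊤ : ℕ∞) (uncurry v) (Iio 0 ×ˢ univ)) :
    ContDiff ℝ 2 (fun q : EuclideanSpace ℝ (Fin 3) × ℝ => dictProfile α v q.1 q.2) := by
  have hL : ContDiff ℝ (⊤ : ℕ∞) (uncurry (lerayOrbit v)) := contDiff_uncurry_lerayOrbit hv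
  have hR3 : ContDiff ℝ (⊤ : ℕ∞) (fun p : ℝ × EuclideanSpace ℝ (Fin 3) => rotZ p.1 p.2) := contDiff_rotZ_uncurry
  have hA : ContDiff ℝ (⊤ : ℕ∞) (fun q : EuclideanSpace ℝ (Fin 3) × ℝ => α * q.2) := contDiff_const.mul contDiff_snd
  have hφ : ContDiff ℝ (⊤ : ℕ∞) (fun q : EuclideanSpace ℝ (Fin 3) × ℝ => (α * q.2, q.1)) := hA.prodMk contDiff_fst
  have h1 : ContDiff ℝ (⊤ : ℕ∞) (fun q : EuclideanSpace ℝ (Fin 3) × ℝ => rotZ (α * q.2) q.1) := by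
    have h := hR3.comp hφ
    exact h
  have hψ : ContDiff ℝ (⊤ : ℕ∞) (fun q : EuclideanSpace ℝ (Fin 3) × ℝ => (q.2, rotZ (α * q.2) q.1)) :=
    contDiff_snd.prodMk h1
  have h2 : ContDiff ℝ (⊤ : ℕ∞) (fun q : EuclideanSpace ℝ (Fin 3) × ℝ => lerayOrbit v q.2 (rotZ (α * q.2) q.1)) := by
    have h := hL.comp hψ
    exact h
  have hχ : ContDiff ℝ (⊤ : ℕ∞)
      (fun q : EuclideanSpace ℝ (Fin 3) × ℝ => (-(α * q.2), lerayOrbit v q.2 (rotZ (α * q.2) q.1))) := hA.neg.prodMk h2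
  have h3 : ContDiff ℝ (⊤ : ℕ∞)
      (fun q : EuclideanSpace ℝ (Fin 3) × ℝ => rotZ (-(α * q.2)) (lerayOrbit v q.2 (rotZ (α * q.2) q.1))) := by
    have h := hR3.comp hχ
    exact h
  exact h3.of_le (by norm_cast)

/-- **THE RDSS DICTIONARY (PROVED).** -/
theorem rdssDictionary_holds : RDSSDictionary := by
  intro c θ hc v hv hR
  exact ⟨dictProfile (-θ / (2 * Real.log c)) v, contDiff_dictProfile _ hv, fun y s => dictProfile_add_period hc hR y s,
    fun t ht x => (pvAnsatz_dictProfile _ v ht.2 x).symm⟩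

/-- **DOOR T5-R(i) «no near-one slowly-twisting single echo» — PROVED** (Pineau–Vicol 2026 Thm 1.7 (i) in the tree + the dictionary). -/
theorem targetNearOneTwistedEcho_holds : TargetNearOneTwistedEcho :=
  targetNearOneTwistedEcho_of_dictionary rdssDictionary_holds

/-- **DOOR T5-R(ii) «no near-one rapidly-twisting single echo» — PROVED** (Pineau–Vicol 2026 Thm 1.7 (ii) in the tree + the dictionary). -/
theorem targetNearOneRapidTwistEcho_holds : TargetNearOneRapidTwistEcho :=
  targetNearOneRapidTwistEcho_of_dictionary rdssDictionary_holds

end Dictionary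

end Summit.NavierStokesRegularity.NavierStokesRegularity.Theorems.PeepholeEchoDoorNearOneTwisted

end
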